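/-
Copyright: the b2b-balaban T⁴-continuum CRUX team, row NE7b OWNER lineage `t4-ne7b-p1` (gen 145). Project licence.
-/
import Summits.QuantumFields.BalabanUV.T4Continuum.Spine.NE7b.SupFiniteRangeGeometryLetters

/-!
# THE RATE BOOKKEEPING OF THE WEIGHTED CLASS (SCOPING-d17 (R-d)).  The weighted class files (652), (657)∕(658), (659), (662)–(671) take
# their weights abstractly: `ϑ ≥ 1` symmetric submultiplicative, `ϑ³ ≤ ϑ₂` (order 4; `ϑ² ≤ ϑ₂` at orders 2–3), `ϑ⁴ ≤ σ(x,w)σ(y,w)` (crossing),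
# the transport `σ(v,z′) ≤ ϑ₂(v,u)·σA(u,z′)` ((659)∕(666)), and the road's `ρ⁸ ≤ σσ`, `r²⁴ ≤ σσ` ((526)∕(655)).  THIS FILE is the
# EXPONENTIAL INSTANCE on a pseudometric space `X` (sites `p : ι → X`, sampler points `q : κ → X`): `ϑ = e^{ν d}`, `ϑ₂ = e^{ν₂ d}`,
# `σ, σA = e^{s d(p·,q·)}`, `ρ = e^{η d}`, `r = e^{ζ d}` satisfy every algebraic hypothesis above as soon as the RATES obey
#   `ν ≥ 0`,  `kν ≤ ν₂` (power `k`),  `kν ≤ s` (crossing power `k`),  `s ≤ ν₂` (transport),  `8η ≤ s`,  `24ζ ≤ s`;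
# the geometry letters (`Θ6 = sup Σ ϑ⁶∕ϑ₂`, `G = sup Σ ϑ⁴∕√ρ`, `S4 = sup Σ ϑ⁴r⁻²`, `Sϑ2`) are then lattice sums of `e^{−(rate gap)·d}`, finite iff
# `ν₂ > 6ν`, `η > 8ν`, `ζ > 2ν` (plus dimension margins) — hypotheses of the slot files, not typed here.  READING (honest): the chain forces
# `s ≥ 8η > 64ν` and `ν₂ ≥ s`, so the INPUT letters (weighted by `ϑ₂`) must come from a previous OUTPUT weight `ϑ` rescaled by `L` ((433):
# `d ↦ L·d`, i.e. `ν ↦ L·ν`, lemma `expw_rescale`) with `L·ν ≥ ν₂ > 64ν`: the weighted class iterates for BLOCKING FACTOR `L > 64` (any fixed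
# large `L`, as in the programme), the powers `8`, `24` of (526) being the cost drivers (row NE7b, node U5c; (476) `expw_triangle` BY NAME;
# Mathlib; [folklore]).

Cell `pub-balaban`, sub-cell `t4`, spine estimate NE7b (`T4WeightBudget.RelWeightBound`; the cell's OWN estimate — NOT PRINTED in
[Bałaban 1983–89], NOT PROVED).  Crux-route work under `Spine/NE7b/` by the row OWNER (`t4-ne7b-p1` gen 145, file (672)) under FREEZE
(0)'s crux-prover clause; NOTHING of Bałaban's is named as a Lean object, valued or asserted; no `T4Continuum/Support` leaf typed; no
`def`, no notation; zero `sorry`.  Imports (BY NAME): the OWNER's (476) `…SupFiniteRangeGeometryLetters` (`expw_triangle`).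

WHAT IS PROVED ([folklore]): **`expw_one_le`**, `expw_symm`, **`expw_submult`**, **`expw_pow_le`** (`ϑᵏ ≤ ϑ₂`), **`expw_pow_le_cross`**
(`ϑᵏ ≤ σσ`), **`expw_transport`** (`σ ≤ ϑ₂·σA`), `expw_rescale`; toy.

HONEST (what this is NOT).  Pointwise algebra of exponential weights; the lattice sums (geometry letters) and the choice of `L` are not typed;
scalar skeleton ((A3), NC-NE7b-α UNRULED); nothing of Bałaban's asserted.  BY-NAME EFFECT ON THE WALL: NONE.  NE7b NOT PRINTED ∕ NOT PROVED;
spine PROVED 0∕9; rung (B)+1 — the programme's measures remain FINITE-torus statements; NOT the mass gap, NOT Clay.  HONEST DEPENDENCY: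
continuum YM on T⁴ ⇐ BetaPertH ∧ nine spine estimates (0∕9 proved); BetaPertH ⇐ (D1) ∧ (D4) ∧ CAP+tail; G-an2-4 gates asym, D1 and NE2∕3∕4.
-/

set_option autoImplicit false

noncomputable section

namespace Summit.QuantumFields.BalabanUV.T4Continuum.NE7b.SupWeightedClassRates

open Real
open SupFiniteRangeGeometryLetters (expw_triangle)

variable {ι κ X : Type} [PseudoMetricSpace X] {p : ι → X} {q : κ → X} {ν ν₂ s : ℝ}

/-- `ϑ = e^{νd} ≥ 1` for `ν ≥ 0`. [folklore] -/
theorem expw_one_le (hν : 0 ≤ ν) (x y : ι) : 1 ≤ Real.exp (ν * dist (p x) (p y)) :=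
  Real.one_le_exp (mul_nonneg hν dist_nonneg)

/-- `ϑ` is symmetric. [folklore] -/
theorem expw_symm (x y : ι) : Real.exp (ν * dist (p x) (p y)) = Real.exp (ν * dist (p y) (p x)) := by
  rw [dist_comm]

/-- `ϑ` is submultiplicative: `ϑ(x,z) ≤ ϑ(x,y)ϑ(y,z)` (the triangle inequality). [folklore] -/
theorem expw_submult (hν : 0 ≤ ν) (x y z : ι) :
    Real.exp (ν * dist (p x) (p z)) ≤ Real.exp (ν * dist (p x) (p y)) * Real.exp (ν * dist (p y) (p z)) :=
  expw_triangle hν _ _ _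

/-- **Powers into the input weight**: `kν ≤ ν₂ ⟹ ϑᵏ ≤ ϑ₂` (`k = 2` at orders 2–3, `k = 3` at order 4). [folklore] -/
theorem expw_pow_le (k : ℕ) (hk : (k : ℝ) * ν ≤ ν₂) (x y : ι) :
    Real.exp (ν * dist (p x) (p y)) ^ k ≤ Real.exp (ν₂ * dist (p x) (p y)) := by
  rw [← Real.exp_nat_mul, Real.exp_le_exp, ← mul_assoc]
  exact mul_le_mul_of_nonneg_right hk dist_nonneg

/-- **Crossing powers through the sampler**: `0 ≤ ν`, `kν ≤ s ⟹ ϑ(x,y)ᵏ ≤ σ(x,w)σ(y,w)` with `σ = e^{s d(p·,q·)}` (`k = 2` at orders 2–3,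
`k = 4` at order 4). [folklore] -/
theorem expw_pow_le_cross (k : ℕ) (hν : 0 ≤ ν) (hk : (k : ℝ) * ν ≤ s) (x y : ι) (w : κ) :
    Real.exp (ν * dist (p x) (p y)) ^ k ≤ Real.exp (s * dist (p x) (q w)) * Real.exp (s * dist (p y) (q w)) := by
  have hs : 0 ≤ s := le_trans (mul_nonneg (Nat.cast_nonneg k) hν) hk
  rw [← Real.exp_nat_mul, ← Real.exp_add, Real.exp_le_exp, ← mul_assoc, ← mul_add]
  calc (k : ℝ) * ν * dist (p x) (p y) ≤ s * dist (p x) (p y) := mul_le_mul_of_nonneg_right hk dist_nonneg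
    _ ≤ s * (dist (p x) (q w) + dist (p y) (q w)) := by
        refine mul_le_mul_of_nonneg_left ?_ hs
        rw [dist_comm (p y) (q w)]
        exact dist_triangle _ _ _

/-- **The transport of (659)∕(666)**: `0 ≤ s ≤ ν₂ ⟹ σ(v,z′) ≤ ϑ₂(v,u)·σA(u,z′)` (`σA = σ`'s rate on the factor side). [folklore] -/
theorem expw_transport (hs : 0 ≤ s) (hsν : s ≤ ν₂) (v u : ι) (z' : κ) :
    Real.exp (s * dist (p v) (q z')) ≤ Real.exp (ν₂ * dist (p v) (p u)) * Real.exp (s * dist (p u) (q z')) :=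
  calc Real.exp (s * dist (p v) (q z')) ≤ Real.exp (s * dist (p v) (p u)) * Real.exp (s * dist (p u) (q z')) := expw_triangle hs _ _ _
    _ ≤ Real.exp (ν₂ * dist (p v) (p u)) * Real.exp (s * dist (p u) (q z')) :=
        mul_le_mul_of_nonneg_right (Real.exp_le_exp.2 (mul_le_mul_of_nonneg_right hsν dist_nonneg)) (Real.exp_pos _).le

/-- **Rescaling** ((433): distances `d ↦ L·d`): the weight of rate `ν` on the rescaled lattice is the weight of rate `L·ν`. [folklore] -/
theorem expw_rescale (L d : ℝ) : Real.exp (ν * (L * d)) = Real.exp ((L * ν) * d) := by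
  rw [← mul_assoc, mul_comm ν L]

/-! ## Toy -/

/-- Toy (the rate chain in numbers): with `ν = 1`, `η = 9 > 8`, `s = 72 ≥ 8η`, `ν₂ = 72 ≥ s > 6`, a blocking factor `L = 72 ≥ ν₂` closes
the chain. -/
example : (8 : ℝ) * 9 ≤ 72 ∧ (6 : ℝ) < 72 ∧ (3 : ℝ) * 1 ≤ 72 ∧ (4 : ℝ) * 1 ≤ 72 := by norm_num

end Summit.QuantumFields.BalabanUV.T4Continuum.NE7b.SupWeightedClassRates

end
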